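import Summits.HodgeConjecture.HodgeConjecture.Theorems.EightfoldBlochSeedsChernCharacterOnBettiAnalytificationComplex
import Literature.AlgebraicGeometry.HodgeTheory.IndependentSectionsSupportedClasses
import HarnessLib

/-!
# K1 → cycle laws (K3 route, topological half): Chern classes of an analytification with `k` algebraic
# sections independent off a closed `Z` of codimension `≥ p` lie in `Nᵖ`

Route `EightfoldBlochSeeds` / item `stmt-HodgeConjecture-19780` (`ChernCharacterOnBetti`), helper
(`--supports`). HONEST FRAMING: nothing here proves 19780 / 18880 / 18882 / 18883 / H2 / HC_AV / HC;
no definition, no named fact.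

WHAT. For a topological comparison datum `(E, α)` (steps K1a–K1d) of an `𝒪_X`-module `F` on a smooth
projective complex `X`, a Zariski open `U` and algebraic sections `s₁, …, s_k ∈ Γ(F, U)` which are,
locally on `U`, members of an algebraic frame of `F` (so that their values `α(sⱼ)(P)` are linearly
independent at every complex point `P` of `U`), the Chern classes `cᵢ(E)_R`, `i ≥ rank E - k + 1`,
restrict to zero on `U(ℂ)` and lie in `Nᵖ H²ⁱ(X(ℂ); R)` whenever every point of `Z = X ∖ U` has
codimension `≥ p`; with `p = i` and `R = ℂ`: `cᵢ(E)_ℂ ∈ algebraicClasses X i`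
(`chernClassIn_complex_mem_algebraicClasses_of_comparison_sections`). This is the topological half of
the algebraicity of the Chern classes of algebraic vector bundles via degeneracy loci (Fulton Thm. 14.4
/ Ex. 14.4.1: for `F` globally generated and `r - i + 1` general sections the dependency locus has
codimension `i` — the algebraic half, Kleiman–Bertini, is not here); it extends the frame case
`k = r` (`…AnalytificationComplex`: `cᵢ ∈ N¹`) through Milnor–Stasheff §4 Prop. 4 / §14
(`IndependentSectionsChernClasses`, `IndependentSectionsSupportedClasses`).

[cite: Fulton1998, Thm. 14.4, Example 14.4.1 and Prop. 19.1.2] [cite: BlochOgus1974ENS, (3.8)]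
[cite: MilnorStasheff1974, §4 Prop. 4 and §14] [cite: SerreGAGA1956, §4 n°20]
-/

noncomputable section

-- single-problem summit (Problem = Summit): the mandated namespace repeats `HodgeConjecture`.
set_option linter.dupNamespace false

open CategoryTheory AlgebraicGeometry Bundle Topology
open Literature.AlgebraicGeometry.Motives Literature.AlgebraicGeometry.HodgeTheory
open Literature.AlgebraicTopology.SingularHomology Literature.AlgebraicTopology.CharacteristicClasses

namespace Summit.HodgeConjecture.HodgeConjecture.Theorems

variable {n : ℕ} {X : SchemeOver ℂ} {F : X.left.Modules} {r : ℕ}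

/-- **The values of sections which are locally members of algebraic frames are independent at every
complex point.** [cite: SerreGAGA1956, §3 n°9 Déf. 2 and §4 n°20] -/
theorem linearIndependent_comparison_of_locally_frame
    (E : ComplexVectorBundle.{0, 0} (ComplexPoints X))
    (α : ∀ U : X.left.Opens, Γ(F, U) → ∀ P : ComplexPoints X, E.E P)
    (hres : ∀ (U W : X.left.Opens) (hWU : W ≤ U) (σ : Γ(F, U)) (P : ComplexPoints X), P.pt ∈ W →
      α W (F.presheaf.map (homOfLE hWU).op σ) P = α U σ P)
    (hframe : ∀ (U : X.left.Opens) (t : Fin r → Γ(F, U)), IsSectionFrame F U t →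
      ∀ P : ComplexPoints X, P.pt ∈ U → LinearIndependent ℂ (fun j ↦ α U (t j) P) ∧
        ⊤ ≤ Submodule.span ℂ (Set.range fun j ↦ α U (t j) P))
    {U : X.left.Opens} {m : ℕ} (s : Fin m → Γ(F, U))
    (hs : ∀ x ∈ U, ∃ (W : X.left.Opens) (hWU : W ≤ U) (t : Fin r → Γ(F, W)) (ι : Fin m → Fin r),
      x ∈ W ∧ Function.Injective ι ∧ IsSectionFrame F W t ∧
        ∀ k, t (ι k) = F.presheaf.map (homOfLE hWU).op (s k))
    (P : ComplexPoints X) (hP : P.pt ∈ U) : LinearIndependent ℂ (fun k ↦ α U (s k) P) := by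
  obtain ⟨W, hWU, t, ι, hxW, hι, ht, hts⟩ := hs P.pt hP
  have h := ((hframe W t ht P hxW).1).comp ι hι
  have heq : (fun k ↦ α U (s k) P) = fun k ↦ α W (t (ι k)) P :=
    funext fun k ↦ by rw [hts k, hres U W hWU (s k) P hxW]
  rw [heq]
  exact h

/-- **`cᵢ(E)_R|_{U(ℂ)} = 0` for `i ≥ rank E - k + 1`** when `F` has `k` algebraic sections over `U`
which are locally members of algebraic frames, for a topological comparison datum `(E, α)` of `F` on a
smooth projective `X`. [cite: MilnorStasheff1974, §4 Prop. 4 and §14] [cite: SerreGAGA1956, §4 n°20] -/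
theorem chernClassIn_restrictToOpen_eq_zero_of_comparison_sections (hX : IsSmoothProjective n X)
    (R : Type) [CommRing R] (E : ComplexVectorBundle.{0, 0} (ComplexPoints X))
    (α : ∀ U : X.left.Opens, Γ(F, U) → ∀ P : ComplexPoints X, E.E P)
    (hres : ∀ (U W : X.left.Opens) (hWU : W ≤ U) (σ : Γ(F, U)) (P : ComplexPoints X), P.pt ∈ W →
      α W (F.presheaf.map (homOfLE hWU).op σ) P = α U σ P)
    (hcont : ∀ (U : X.left.Opens) (σ : Γ(F, U)),
      ContinuousOn (fun P ↦ (⟨P, α U σ P⟩ : TotalSpace E.F E.E)) {P | P.pt ∈ U})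
    (hframe : ∀ (U : X.left.Opens) (t : Fin r → Γ(F, U)), IsSectionFrame F U t →
      ∀ P : ComplexPoints X, P.pt ∈ U → LinearIndependent ℂ (fun j ↦ α U (t j) P) ∧
        ⊤ ≤ Submodule.span ℂ (Set.range fun j ↦ α U (t j) P))
    {U : X.left.Opens} {m : ℕ} (s : Fin m → Γ(F, U))
    (hs : ∀ x ∈ U, ∃ (W : X.left.Opens) (hWU : W ≤ U) (t : Fin r → Γ(F, W)) (ι : Fin m → Fin r),
      x ∈ W ∧ Function.Injective ι ∧ IsSectionFrame F W t ∧
        ∀ k, t (ι k) = F.presheaf.map (homOfLE hWU).op (s k))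
    {i : ℕ} (hi : E.rank < i + m) (hi0 : 0 < i) :
    restrictToCompl R X (2 * i) ((U : Set X.left)ᶜ) (theChernClassTheory.chernClassIn R E i) = 0 :=
  chernClassIn_restrictToCompl_eq_zero_of_sections hX R E U.2.isClosed_compl
    (fun k P ↦ α U (s k) P.1)
    (fun k ↦ (hcont U (s k)).comp_continuous continuous_subtype_val fun P ↦ Set.notMem_compl_iff.1 P.2)
    (fun P ↦ linearIndependent_comparison_of_locally_frame E α hres hframe s hs P.1
      (Set.notMem_compl_iff.1 P.2)) hi hi0

/-- **`cᵢ(E)_R ∈ Nᵖ H²ⁱ(X(ℂ); R)`** when, moreover, every point of the closed complement `X ∖ U` has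
codimension `≥ p`. [cite: BlochOgus1974ENS, (3.8)] [cite: MilnorStasheff1974, §4 Prop. 4 and §14] -/
theorem chernClassIn_mem_coniveauFiltration_of_comparison_sections (hX : IsSmoothProjective n X)
    (R : Type) [CommRing R] (E : ComplexVectorBundle.{0, 0} (ComplexPoints X))
    (α : ∀ U : X.left.Opens, Γ(F, U) → ∀ P : ComplexPoints X, E.E P)
    (hres : ∀ (U W : X.left.Opens) (hWU : W ≤ U) (σ : Γ(F, U)) (P : ComplexPoints X), P.pt ∈ W →
      α W (F.presheaf.map (homOfLE hWU).op σ) P = α U σ P)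
    (hcont : ∀ (U : X.left.Opens) (σ : Γ(F, U)),
      ContinuousOn (fun P ↦ (⟨P, α U σ P⟩ : TotalSpace E.F E.E)) {P | P.pt ∈ U})
    (hframe : ∀ (U : X.left.Opens) (t : Fin r → Γ(F, U)), IsSectionFrame F U t →
      ∀ P : ComplexPoints X, P.pt ∈ U → LinearIndependent ℂ (fun j ↦ α U (t j) P) ∧
        ⊤ ≤ Submodule.span ℂ (Set.range fun j ↦ α U (t j) P))
    {U : X.left.Opens} {p : ℕ} (hp : ∀ z ∈ (U : Set X.left)ᶜ, (p : ℕ∞) ≤ Order.coheight z)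
    {m : ℕ} (s : Fin m → Γ(F, U))
    (hs : ∀ x ∈ U, ∃ (W : X.left.Opens) (hWU : W ≤ U) (t : Fin r → Γ(F, W)) (ι : Fin m → Fin r),
      x ∈ W ∧ Function.Injective ι ∧ IsSectionFrame F W t ∧
        ∀ k, t (ι k) = F.presheaf.map (homOfLE hWU).op (s k))
    {i : ℕ} (hi : E.rank < i + m) (hi0 : 0 < i) :
    theChernClassTheory.chernClassIn R E i ∈ coniveauFiltration R X (2 * i) p :=
  mem_coniveauFiltration_of_restrictToCompl_eq_zero (A := R) (q := 2 * i) U.2.isClosed_compl hp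
    (chernClassIn_restrictToOpen_eq_zero_of_comparison_sections hX R E α hres hcont hframe s hs hi hi0)

/-- **`cᵢ(F(ℂ))_ℂ ∈ algebraicClasses X i`** for a topological analytification `(E, α)` of `F` on a
smooth projective `X`, as soon as `F` has `rank E - i + 1` (or more) algebraic sections over a Zariski
open `U`, locally members of frames, whose closed complement has codimension `≥ i` — the shape in
which the field `ch_mem_algebraicClasses` (degree `i`, for `cᵢ`) follows from the existence of general
sections with a dependency locus of the expected codimension (Fulton Thm. 14.4; Kleiman–Bertini).
[cite: Fulton1998, Thm. 14.4, Example 14.4.1 and Prop. 19.1.2] [cite: BlochOgus1974ENS, (3.8)] -/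
theorem chernClassIn_complex_mem_algebraicClasses_of_comparison_sections (hX : IsSmoothProjective n X)
    (E : ComplexVectorBundle.{0, 0} (ComplexPoints X))
    (α : ∀ U : X.left.Opens, Γ(F, U) → ∀ P : ComplexPoints X, E.E P)
    (hres : ∀ (U W : X.left.Opens) (hWU : W ≤ U) (σ : Γ(F, U)) (P : ComplexPoints X), P.pt ∈ W →
      α W (F.presheaf.map (homOfLE hWU).op σ) P = α U σ P)
    (hcont : ∀ (U : X.left.Opens) (σ : Γ(F, U)),
      ContinuousOn (fun P ↦ (⟨P, α U σ P⟩ : TotalSpace E.F E.E)) {P | P.pt ∈ U})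
    (hframe : ∀ (U : X.left.Opens) (t : Fin r → Γ(F, U)), IsSectionFrame F U t →
      ∀ P : ComplexPoints X, P.pt ∈ U → LinearIndependent ℂ (fun j ↦ α U (t j) P) ∧
        ⊤ ≤ Submodule.span ℂ (Set.range fun j ↦ α U (t j) P))
    {U : X.left.Opens} {i : ℕ} (hcodim : ∀ z ∈ (U : Set X.left)ᶜ, (i : ℕ∞) ≤ Order.coheight z)
    {m : ℕ} (s : Fin m → Γ(F, U))
    (hs : ∀ x ∈ U, ∃ (W : X.left.Opens) (hWU : W ≤ U) (t : Fin r → Γ(F, W)) (ι : Fin m → Fin r),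
      x ∈ W ∧ Function.Injective ι ∧ IsSectionFrame F W t ∧
        ∀ k, t (ι k) = F.presheaf.map (homOfLE hWU).op (s k))
    (hi : E.rank < i + m) (hi0 : 0 < i) :
    theChernClassTheory.chernClassIn ℂ E i ∈ algebraicClasses X i :=
  chernClassIn_mem_coniveauFiltration_of_comparison_sections hX ℂ E α hres hcont hframe hcodim s hs hi hi0

end Summit.HodgeConjecture.HodgeConjecture.Theorems

end
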